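import Mathlib.LinearAlgebra.Matrix.NonsingularInverse
import Mathlib.LinearAlgebra.Basis.VectorSpace
import Mathlib.LinearAlgebra.Dimension.StrongRankCondition
import Mathlib.LinearAlgebra.FiniteDimensional.Defs
import Mathlib.RingTheory.Ideal.Operations
import Mathlib.RingTheory.Polynomial.Resultant.Basic
import Mathlib.RingTheory.Polynomial.UniqueFactorization
import Mathlib.Algebra.MvPolynomial.Degrees
import Mathlib.RingTheory.MvPolynomial.Basic
import HarnessLib

/-!
# Cafure–Matera Lemma 2.2, proof part A: the Sylvester resultant in the coefficient variables

Support file for the proof of `Literature.NumberTheory.DiophantineGeometry.CafureMatera2006_lemma22`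
(`CafureMatera.lean`; assembled in `CafureMateraLemma22Proofs.lean`). Everything here is proved;
no statement of `CafureMatera.lean` is touched.

For `F, G ∈ A[t]` with `A = K[X_1,…,X_n]`, `F` monic of `t`-degree `d`, we study Mathlib's
Sylvester resultant `R = Polynomial.resultant F G d n'` (`n' ≥ deg_t G`):

* `resultant_ne_zero_of_isRelPrime`: `R ≠ 0` when `F, G` are relatively prime in `A[t]`
  (kernel of the Sylvester map + `Matrix.exists_mulVec_eq_zero_iff`);
* `totalDegree_resultant_le`: `deg R ≤ d d'` when `deg (coeff of t^i) ≤ d - i` in `F` and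
  `≤ d' - i` in `G` (Leibniz expansion with column weights);
* `resultant_mem_pow_ker_eval`: if `F(a,·), G(a,·)` have `k` common roots `t ∈ T ⊆ K`, then
  `R ∈ 𝔪_a^k` (`𝔪_a = ker eval_a`): the specialised Sylvester matrix has the `k` independent kernel
  vectors `(∏_{l ∈ T∖t}(X-l)·u_F, -∏_{l∈T∖t}(X-l)·u_G)`, and a matrix congruent mod `I` to a constant
  matrix with `k` independent kernel vectors has determinant in `I^k`
  (`det_mem_pow_of_linearIndependent`, change of basis + Leibniz).

These are standard facts of elimination theory (e.g. Cox–Little–O'Shea, *Ideals, Varieties, and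
Algorithms*, Ch. 3 §6), recorded here in the exact form the proof needs. [folklore]
-/

namespace Literature.NumberTheory.DiophantineGeometry.CafureMateraLemma22

open Matrix

/-- A product with `#s` factors in the ideal `I` lies in `I ^ #s`. [folklore] -/
theorem prod_mem_pow_card {A ι : Type*} [CommRing A] (I : Ideal A) (s : Finset ι) (x : ι → A)
    (hx : ∀ i ∈ s, x i ∈ I) : ∏ i ∈ s, x i ∈ I ^ s.card := by
  classical
  induction s using Finset.induction_on with
  | empty => simp
  | insert a s ha ih =>
    rw [Finset.prod_insert ha, Finset.card_insert_of_notMem ha, pow_succ']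
    exact Ideal.mul_mem_mul (hx a (by simp)) (ih fun i hi => hx i (by simp [hi]))

/-- If the columns indexed by `s` of a square matrix have all entries in `I`, its determinant lies
in `I ^ #s` (Leibniz expansion). [folklore] -/
theorem det_mem_pow_of_cols_mem {A ι : Type*} [CommRing A] [Fintype ι] [DecidableEq ι]
    (I : Ideal A) (N : Matrix ι ι A) (s : Finset ι) (hs : ∀ j ∈ s, ∀ i, N i j ∈ I) :
    N.det ∈ I ^ s.card := by
  rw [Matrix.det_apply']
  refine Submodule.sum_mem _ fun σ _ => Ideal.mul_mem_left _ _ ?_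
  rw [← Finset.prod_mul_prod_compl s]
  exact Ideal.mul_mem_right _ _ (prod_mem_pow_card I s _ fun i hi => hs i hi (σ i))

/-- **Determinants of lifts of singular matrices.** Let `M` be a square matrix over a `K`-algebra
`A`, congruent modulo the ideal `I` to a constant matrix `M₀` over the field `K`. If `M₀` kills a
linearly independent family of `k` vectors, then `det M ∈ I ^ k`: after a constant change of basis
bringing the `k` vectors into the basis, `k` columns of `M` lie in `I`. [folklore] -/
theorem det_mem_pow_of_linearIndependent {K A ι : Type*} [Field K] [CommRing A]
    [Algebra K A] [Fintype ι] [DecidableEq ι] (I : Ideal A) (M : Matrix ι ι A) (M₀ : Matrix ι ι K)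
    (hM : ∀ i j, M i j - algebraMap K A (M₀ i j) ∈ I) {κ : Type*} [Fintype κ] (v : κ → ι → K)
    (hv : LinearIndependent K v) (hv0 : ∀ l, M₀ *ᵥ v l = 0) : M.det ∈ I ^ Fintype.card κ := by
  classical
  let b := Module.Basis.extend hv.linearIndepOn_id
  have hb : ∀ x, b x = (x : ι → K) := Module.Basis.extend_apply_self _
  have hsub : Set.range v ⊆ hv.linearIndepOn_id.extend (Set.subset_univ _) :=
    Module.Basis.subset_extend _
  let e := b.indexEquiv (Pi.basisFun K ι)
  let P : Matrix ι ι K := Matrix.of fun i j => (e.symm j : ι → K) i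
  have hPunit : IsUnit P := by
    rw [← Matrix.linearIndependent_cols_iff_isUnit]
    have : P.col = fun j => b (e.symm j) := by
      funext j; rw [hb]; rfl
    rw [this]
    exact b.linearIndependent.comp _ e.symm.injective
  let P' : Matrix ι ι A := P.map (algebraMap K A)
  have hP'unit : IsUnit P'.det := by
    have : P'.det = algebraMap K A P.det := by
      rw [RingHom.map_det, RingHom.mapMatrix_apply]
    rw [this]
    exact ((Matrix.isUnit_iff_isUnit_det _).1 hPunit).map _
  let ψ : κ → ι := fun l => e ⟨v l, hsub (Set.mem_range_self l)⟩
  have hψ : Function.Injective ψ := by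
    intro l l' h
    have h' := e.injective h
    rw [Subtype.mk.injEq] at h'
    exact hv.injective h'
  have hPcol : ∀ l i', P i' (ψ l) = v l i' := by
    intro l i'
    simp [P, ψ]
  have hcol : ∀ l i, (M * P') i (ψ l) ∈ I := by
    intro l i
    have h1 : (M * P') i (ψ l) =
        ∑ i', (M i i' - algebraMap K A (M₀ i i')) * algebraMap K A (v l i') +
          algebraMap K A ((M₀ *ᵥ v l) i) := by
      simp only [Matrix.mul_apply, Matrix.map_apply, hPcol, Matrix.mulVec, dotProduct, map_sum,
        map_mul, sub_mul, Finset.sum_sub_distrib, sub_add_cancel, P']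
    rw [h1, hv0, Pi.zero_apply, map_zero, add_zero]
    exact Submodule.sum_mem _ fun iQ _ => Ideal.mul_mem_right _ _ (hM i iQ)
  have hdet : (M * P').det ∈ I ^ Fintype.card κ := by
    have := det_mem_pow_of_cols_mem I (M * P') (Finset.univ.map ⟨ψ, hψ⟩) (by
      intro j hj i
      obtain ⟨l, -, rfl⟩ := Finset.mem_map.1 hj
      exact hcol l i)
    simpa using this
  obtain ⟨u, hu⟩ := hP'unit
  have : M.det = (M * P').det * ↑u⁻¹ := by
    rw [Matrix.det_mul, ← hu, Units.mul_inv_cancel_right]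
  rw [this]
  exact Ideal.mul_mem_right _ _ hdet

open MvPolynomial

open scoped Polynomial

/-! ### Nonvanishing of the resultant of relatively prime polynomials -/

/-- If `F` is monic of degree `d` and `F, G` are relatively prime in `A[X]` (`A` a UFD), then the
Sylvester resultant `Res_{d,n'}(F, G)` is nonzero for any `n' ≥ deg G`. [folklore] -/
theorem resultant_ne_zero_of_isRelPrime {A : Type*} [CommRing A] [IsDomain A]
    [DecompositionMonoid A[X]] {F G : A[X]} {d n' : ℕ} (hF : F.Monic) (hFd : F.natDegree = d)
    (hG : G.natDegree ≤ n') (hFG : IsRelPrime F G) : Polynomial.resultant F G d n' ≠ 0 := by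
  classical
  intro h
  obtain ⟨v, hv0, hv⟩ := Matrix.exists_mulVec_eq_zero_iff.2 h
  let b₁ := ((Polynomial.degreeLT.basis A d).prod (Polynomial.degreeLT.basis A n')).reindex
    finSumFinEquiv
  let b₂ := Polynomial.degreeLT.basis A (d + n')
  have hM := Polynomial.toMatrix_sylvesterMap' F G hFd.le hG
  let x := b₁.repr.symm (Finsupp.equivFunOnFinite.symm v)
  have hx : ⇑(b₁.repr x) = v := by simp [x]
  have hmv := LinearMap.toMatrix_mulVec_repr b₁ b₂ (Polynomial.sylvesterMap F G hFd.le hG) x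
  rw [hM, hx, hv] at hmv
  have hfx : Polynomial.sylvesterMap F G hFd.le hG x = 0 := by
    have : b₂.repr (Polynomial.sylvesterMap F G hFd.le hG x) = 0 := by
      ext i
      have := congrFun hmv i
      simpa using this.symm
    simpa using this
  have hval : F * (x.2 : A[X]) + G * (x.1 : A[X]) = 0 := by
    have := congrArg Subtype.val hfx
    simpa [Polynomial.sylvesterMap] using this
  have hdvd : F ∣ (x.1 : A[X]) := by
    refine hFG.dvd_of_dvd_mul_left ⟨-(x.2 : A[X]), ?_⟩
    linear_combination hval
  have hx1 : (x.1 : A[X]) = 0 := by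
    refine Polynomial.eq_zero_of_dvd_of_degree_lt hdvd ?_
    rw [Polynomial.degree_eq_natDegree hF.ne_zero, hFd]
    exact Polynomial.mem_degreeLT.1 x.1.2
  have hx2 : (x.2 : A[X]) = 0 := by
    rw [hx1, mul_zero, add_zero] at hval
    exact (mul_eq_zero.1 hval).resolve_left hF.ne_zero
  have hx0 : x = 0 := Prod.ext (Subtype.ext hx1) (Subtype.ext hx2)
  apply hv0
  rw [← hx, hx0, map_zero]
  rfl

/-! ### Degree of the resultant in the coefficients' variables -/

variable {K : Type*} [Field K]

/-- The total degree of an integer constant is `0`. [folklore] -/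
theorem totalDegree_intCast {n : ℕ} (z : ℤ) :
    ((z : MvPolynomial (Fin n) K)).totalDegree = 0 := by
  rw [← map_intCast (C : K →+* MvPolynomial (Fin n) K) z, totalDegree_C]

/-- **Degree of the resultant.** If the coefficient of `t^i` in `F` (resp. `G`) is a polynomial of
total degree `≤ d - i` (resp. `≤ d' - i`), as happens for polynomials of total degree `d`, `d'`
in `t, X_1, …, X_n`, then `Res_{d,n'}(F, G)` has total degree `≤ d d'` for every `n' ≤ d'`.
[folklore] -/
theorem totalDegree_resultant_le {n : ℕ} (F G : Polynomial (MvPolynomial (Fin n) K))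
    (d d' n' : ℕ) (hF : ∀ i, F.coeff i ≠ 0 → (F.coeff i).totalDegree + i ≤ d)
    (hG : ∀ i, G.coeff i ≠ 0 → (G.coeff i).totalDegree + i ≤ d') :
    (Polynomial.resultant F G d n').totalDegree ≤ d * d' := by
  classical
  let M := Polynomial.sylvester F G d n'
  -- column weights
  let w : Fin (d + n') → ℕ := fun j => Fin.addCases (fun j₁ => d' + (j₁ : ℕ)) (fun j₁ => d + (j₁ : ℕ)) j
  have hw : ∑ j, w j = d * d' + ∑ j : Fin (d + n'), (j : ℕ) := by
    simp only [w, Fin.sum_univ_add, Fin.addCases_left, Fin.addCases_right, Finset.sum_add_distrib,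
      Finset.sum_const, Finset.card_univ, Fintype.card_fin, smul_eq_mul, Fin.val_castAdd,
      Fin.val_natAdd]
    ring
  -- entry bound
  have hE : ∀ i j, M i j = 0 ∨ (M i j).totalDegree + (i : ℕ) ≤ w j := by
    intro i j
    induction j using Fin.addCases with
    | left j₁ =>
      simp only [M, Polynomial.sylvester, Matrix.of_apply, Fin.addCases_left, Set.mem_Icc, w]
      split_ifs with hij
      · by_cases h0 : G.coeff (i - j₁) = 0
        · exact Or.inl h0
        · right
          have := hG _ h0
          omega
      · exact Or.inl rfl
    | right j₁ =>
      simp only [M, Polynomial.sylvester, Matrix.of_apply, Fin.addCases_right, Set.mem_Icc, w]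
      split_ifs with hij
      · by_cases h0 : F.coeff (i - j₁) = 0
        · exact Or.inl h0
        · right
          have := hF _ h0
          omega
      · exact Or.inl rfl
  -- each Leibniz term has degree ≤ d d'
  have hterm : ∀ σ : Equiv.Perm (Fin (d + n')),
      (∏ i, M (σ i) i).totalDegree ≤ d * d' := by
    intro σ
    by_cases hz : ∃ i, M (σ i) i = 0
    · obtain ⟨i, hi⟩ := hz
      rw [Finset.prod_eq_zero (f := fun i => M (σ i) i) (Finset.mem_univ i) hi, totalDegree_zero]
      exact Nat.zero_le _
    · push Not at hz
      have hb : ∀ i, (M (σ i) i).totalDegree + (σ i : ℕ) ≤ w i := fun i =>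
        (hE (σ i) i).resolve_left (hz i)
      have hsum : ∑ i, ((M (σ i) i).totalDegree + (σ i : ℕ)) ≤ ∑ i, w i :=
        Finset.sum_le_sum fun i _ => hb i
      rw [Finset.sum_add_distrib, hw, Equiv.sum_comp σ (fun i : Fin (d + n') => (i : ℕ))] at hsum
      calc (∏ i, M (σ i) i).totalDegree ≤ ∑ i, (M (σ i) i).totalDegree :=
            totalDegree_finsetProd _ _
        _ ≤ d * d' := by omega
  show (M.det).totalDegree ≤ d * d'
  rw [Matrix.det_apply']
  refine totalDegree_finsetSum_le fun σ _ => ?_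
  calc (((Equiv.Perm.sign σ : ℤ) : MvPolynomial (Fin n) K) * ∏ i, M (σ i) i).totalDegree
      ≤ ((Equiv.Perm.sign σ : ℤ) : MvPolynomial (Fin n) K).totalDegree +
          (∏ i, M (σ i) i).totalDegree := totalDegree_mul _ _
    _ ≤ 0 + d * d' := by
        gcongr
        · exact (totalDegree_intCast _).le
        · exact hterm σ
    _ = d * d' := zero_add _

/-! ### Vanishing order of the resultant at a point with many common roots -/

/-- Lagrange-type products are linearly independent: for a finite set `T ⊂ K`, the polynomials
`∏_{l ∈ T, l ≠ t} (X - l)`, `t ∈ T`, are linearly independent. [folklore] -/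
theorem linearIndependent_prod_erase_X_sub_C [DecidableEq K] (T : Finset K) :
    LinearIndependent K (fun t : T => ∏ l ∈ T.erase t, (Polynomial.X - Polynomial.C l)) := by
  classical
  rw [Fintype.linearIndependent_iff]
  intro g hg t₀
  have h := congrArg (Polynomial.eval (t₀ : K)) hg
  rw [Polynomial.eval_finsetSum, Polynomial.eval_zero,
    Finset.sum_eq_single t₀] at h
  · rw [Polynomial.eval_smul, smul_eq_mul, Polynomial.eval_prod] at h
    refine (mul_eq_zero.1 h).resolve_right (Finset.prod_ne_zero_iff.2 fun l hl => ?_)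
    rw [Polynomial.eval_sub, Polynomial.eval_X, Polynomial.eval_C]
    exact sub_ne_zero.2 (Finset.ne_of_mem_erase hl).symm
  · intro t _ ht
    rw [Polynomial.eval_smul, Polynomial.eval_prod,
      Finset.prod_eq_zero (Finset.mem_erase.2 ⟨fun h => ht (Subtype.ext h.symm), t₀.2⟩)]
    · simp
    · simp
  · intro h
    exact absurd (Finset.mem_univ t₀) h

/-- **Vanishing order of the resultant.** Let `F, G ∈ A[t]`, `A = K[X_1,…,X_n]`, `F` monic of
degree `d`, `deg G ≤ n'`, and let `a ∈ Kⁿ`. If the specialisations `F(a, t), G(a, t)` have (at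
least) the common roots `t ∈ T`, then `Res_{d,n'}(F, G)` lies in the `#T`-th power of the maximal
ideal of `a`: the specialised Sylvester matrix has `#T` independent kernel vectors. [folklore] -/
theorem resultant_mem_pow_ker_eval [DecidableEq K] {n : ℕ}
    (F G : Polynomial (MvPolynomial (Fin n) K))
    {d n' : ℕ} (hF : F.Monic) (hFd : F.natDegree = d) (hG : G.natDegree ≤ n') (a : Fin n → K)
    (T : Finset K)
    (hT : ∀ t ∈ T, (F.map (eval a)).IsRoot t ∧ (G.map (eval a)).IsRoot t) :
    Polynomial.resultant F G d n' ∈ RingHom.ker (eval a) ^ T.card := by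
  -- specialisations
  set Fa := F.map (eval a) with hFa
  set Ga := G.map (eval a) with hGa
  have hFam : Fa.Monic := hF.map _
  have hFad : Fa.natDegree = d := by rw [hFa, hF.natDegree_map, hFd]
  have hGad : Ga.natDegree ≤ n' := (Polynomial.natDegree_map_le).trans hG
  -- the product of the linear factors divides both
  set PT : K[X] := ∏ l ∈ T, (Polynomial.X - Polynomial.C l) with hPT
  have hpair := (Polynomial.pairwise_coprime_X_sub_C (K := K) Function.injective_id).set_pairwise
    (T : Set K)
  obtain ⟨uF, huF⟩ : PT ∣ Fa := Finset.prod_dvd_of_coprime hpair fun t ht =>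
    Polynomial.dvd_iff_isRoot.2 (hT t ht).1
  obtain ⟨uG, huG⟩ : PT ∣ Ga := Finset.prod_dvd_of_coprime hpair fun t ht =>
    Polynomial.dvd_iff_isRoot.2 (hT t ht).2
  have hFa0 : Fa ≠ 0 := hFam.ne_zero
  have huF0 : uF ≠ 0 := by rintro rfl; exact hFa0 (by rw [huF, mul_zero])
  -- Lagrange products
  let e : T → K[X] := fun t => ∏ l ∈ T.erase t, (Polynomial.X - Polynomial.C l)
  have he : ∀ t : T, PT = (Polynomial.X - Polynomial.C (t : K)) * e t := fun t =>
    (Finset.mul_prod_erase T (fun l => Polynomial.X - Polynomial.C l) t.2).symm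
  have hediv : ∀ t : T, e t * uF = Fa /ₘ (Polynomial.X - Polynomial.C (t : K)) := by
    intro t
    rw [huF, he t, mul_assoc, Polynomial.mul_divByMonic_cancel_left _ (Polynomial.monic_X_sub_C _)]
  have hedivG : ∀ t : T, e t * uG = Ga /ₘ (Polynomial.X - Polynomial.C (t : K)) := by
    intro t
    rw [huG, he t, mul_assoc, Polynomial.mul_divByMonic_cancel_left _ (Polynomial.monic_X_sub_C _)]
  have hmem1 : ∀ t : T, e t * uF ∈ Polynomial.degreeLT K d := by
    intro t
    rw [Polynomial.mem_degreeLT, hediv, ← hFad, ← Polynomial.degree_eq_natDegree hFa0]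
    exact Polynomial.degree_divByMonic_lt _ _ hFa0
      (by rw [Polynomial.degree_X_sub_C]; exact zero_lt_one)
  have hmem2 : ∀ t : T, -(e t * uG) ∈ Polynomial.degreeLT K n' := by
    intro t
    rw [Polynomial.mem_degreeLT, Polynomial.degree_neg, hedivG]
    by_cases hGa0 : Ga = 0
    · rw [hGa0, Polynomial.zero_divByMonic, Polynomial.degree_zero]
      exact WithBot.bot_lt_coe _
    · exact lt_of_lt_of_le (Polynomial.degree_divByMonic_lt _ _ hGa0
        (by rw [Polynomial.degree_X_sub_C]; exact zero_lt_one))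
        (Polynomial.degree_le_of_natDegree_le hGad)
  let vec : T → Polynomial.degreeLT K d × Polynomial.degreeLT K n' :=
    fun t => (⟨e t * uF, hmem1 t⟩, ⟨-(e t * uG), hmem2 t⟩)
  have hvec0 : ∀ t, Polynomial.sylvesterMap Fa Ga hFad.le hGad (vec t) = 0 := by
    intro t
    apply Subtype.ext
    simp only [Polynomial.sylvesterMap, LinearMap.coe_mk, AddHom.coe_mk, vec, Submodule.coe_zero]
    rw [huF, huG]
    ring
  have hvecli : LinearIndependent K vec := by
    refine LinearIndependent.of_comp
      ((Polynomial.degreeLT K d).subtype.comp (LinearMap.fst K _ _)) ?_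
    have : ⇑((Polynomial.degreeLT K d).subtype.comp (LinearMap.fst K _ _)) ∘ vec =
        fun t : T => e t * uF := by
      funext t; rfl
    rw [this]
    have hinj : LinearMap.ker (LinearMap.mulRight K uF : K[X] →ₗ[K] K[X]) = ⊥ := by
      rw [LinearMap.ker_eq_bot]
      intro p₁ p₂ h
      exact mul_right_cancel₀ huF0 h
    have h2 : LinearIndependent K (⇑(LinearMap.mulRight K uF : K[X] →ₗ[K] K[X]) ∘ e) :=
      (linearIndependent_prod_erase_X_sub_C T).map' _ hinj
    have h3 : (fun t : T => e t * uF) = ⇑(LinearMap.mulRight K uF : K[X] →ₗ[K] K[X]) ∘ e := by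
      funext t
      simp only [Function.comp_apply, LinearMap.mulRight_apply]
    rw [h3]
    exact h2
  -- coordinates
  let b₁ := ((Polynomial.degreeLT.basis K d).prod (Polynomial.degreeLT.basis K n')).reindex
    finSumFinEquiv
  let b₂ := Polynomial.degreeLT.basis K (d + n')
  let v : T → Fin (d + n') → K := fun t => b₁.equivFun (vec t)
  have hvli : LinearIndependent K v := hvecli.map' b₁.equivFun.toLinearMap b₁.equivFun.ker
  let M := Polynomial.sylvester F G d n'
  let M₀ := Polynomial.sylvester Fa Ga d n'
  have hM₀ : M₀ = (eval a).mapMatrix M := by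
    rw [← Polynomial.sylvester_map_map]
  have hMM₀ : ∀ i j, M i j - algebraMap K (MvPolynomial (Fin n) K) (M₀ i j) ∈
      RingHom.ker (eval a) := by
    intro i j
    rw [RingHom.mem_ker, map_sub, hM₀]
    simp
  have hv0 : ∀ t, M₀ *ᵥ v t = 0 := by
    intro t
    have h1 := LinearMap.toMatrix_mulVec_repr b₁ b₂ (Polynomial.sylvesterMap Fa Ga hFad.le hGad)
      (vec t)
    rw [Polynomial.toMatrix_sylvesterMap', hvec0, map_zero] at h1
    have hvt : v t = ⇑(b₁.repr (vec t)) := by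
      funext i; simp [v, Module.Basis.equivFun_apply]
    rw [hvt]
    simpa using h1
  have := det_mem_pow_of_linearIndependent (RingHom.ker (eval a)) M M₀ hMM₀ v hvli hv0
  rwa [Fintype.card_coe] at this

end Literature.NumberTheory.DiophantineGeometry.CafureMateraLemma22
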